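import Mathlib.RingTheory.MvPolynomial.Homogeneous
import Mathlib.Algebra.MvPolynomial.CommRing
import Mathlib.Algebra.MvPolynomial.Degrees
import Mathlib.Data.Finsupp.Antidiagonal
import HarnessLib

/-!
# Top-notch purification: the algebraic core of «semantic multi-(d−1)-ic VP = VP»

Workshop `decomp-valiant`, lens 6 «restricted-models lifting axis», generation 22 — kernel certificate of
the ALGEBRA of NOTE-g21 Lemma 1 (j = 1), the costume zone r ≥ d − 1 of census dial D5 / row C21-1.
Nothing here is about the summit; rung currency: LADDER-Valiant rung 0.

A circuit is (semantically) multi-r-ic when every gate computes a polynomial of individual degree ≤ r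
(Kayal–Saha–Tavenas 2016; Chillara 2020). Individual degree is sub-additive under products and does not
grow under linear combinations (`MvPolynomial.degreeOf_mul_le`, `degreeOf_add_le`), so after
homogenisation (tree: `Literature/…/HomogenisationFormalDegree.lean`) the only gates of a circuit for a
homogeneous degree-`d` polynomial `f` that can violate individual degree `≤ d − 1` are the TOP products
`g · h`, `deg g = a ≥ 1`, `deg h = b ≥ 1`, `a + b = d`, through the pure powers `x_e^a · x_e^b`. This
file proves, over any commutative ring and any finite variable set:

* `purePart a g = Σ_e coeff(x_e^a) g · x_e^a`, `mixedPart a g = g − purePart a g`; for `g` homogeneous of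
  degree `a ≥ 1`, `degreeOf e (mixedPart a g) ≤ a − 1` (`degreeOf_mixedPart_le`);
* `coeff (x_e^{a+b}) (g h) = coeff(x_e^a) g · coeff(x_e^b) h` for homogeneous `g` (any `h`)
  (`coeff_single_mul_of_isHomogeneous`), whence `purePart (a+b) (g h) = Σ_e C(α_e β_e) x_e^{a+b}`;
* the PURIFICATION IDENTITY (`purification_identity`):
  `ĝ·ĥ + ĝ·P_h + P_g·ĥ + Σ_e (C α_e x_e^a)·(P_h − C β_e x_e^b) = mixedPart (a+b) (g·h)`,
  and every product in it, and every factor, has individual degree `≤ a + b − 1` in every variable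
  (`legal_products`, `legal_factors`) — i.e. the `N + 3` products are legal gates of a multi-(d−1)-ic
  circuit, `N = #σ`;
* the TOP LAYER (`top_layer`): if `f = Σ_i c_i • p_i` has no pure monomial of degree `d`
  (`coeff (x_e^d) f = 0` for all `e`, e.g. `f` multilinear and `d ≥ 2`) then `f = Σ_i c_i • mixedPart d p_i`
  — replacing each top product by its purification does not change the output.

Paper-level consequence (NOT typed here: the gate-list assembly over `ArithCircuit`): a pure-power-free
homogeneous `f` of degree `d` with circuits of size `s` has circuits of size `O(s d² N)` all of whose gates
have individual degree `≤ d − 1`; for multilinear p-families `f ∈ VP ⟺ f ∈ semantic-multi-(d−1)-ic VP`, so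
«per_n ∉ semantic multi-(n−1)-ic VP» is VP ≠ VNP re-lettered (COSTUME), census row C21-1.
Companion (paper + machine check, same generation): TEST-I.md (the quasi-polynomial chasm, Lemma 2).

References: N. Kayal, C. Saha, S. Tavenas, *An almost cubic lower bound for depth three arithmetic
circuits* / *On the size of homogeneous and of depth four formulas with low individual degree*, STOC 2016
(multi-r-ic model); S. Chillara, *On computing multilinear polynomials using multi-r-ic depth four
circuits*, STACS 2020, §1 (semantic vs syntactic multi-r-ic) [corpus:paper:doi-10-4230-lipics-stacs-2020-47 p2];
P. Bürgisser, M. Clausen, M. A. Shokrollahi, *Algebraic Complexity Theory* (1997) Lemma (21.25)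
(homogenisation).
-/

noncomputable section

open MvPolynomial

set_option linter.dupNamespace false

namespace Summit.ValiantsHypothesis.ValiantsHypothesis.Theorems.IndividualDegreePurification

universe u v

variable {k : Type u} [CommRing k] {σ : Type v} [Fintype σ]

/-! ## §1. Pure and mixed parts -/

/-- The pure-power part of degree `a`: `Σ_e coeff(x_e^a) g · x_e^a`. -/
def purePart (a : ℕ) (g : MvPolynomial σ k) : MvPolynomial σ k :=
  ∑ e : σ, C (coeff (Finsupp.single e a) g) * X e ^ a

/-- The mixed part: `g` minus its pure-power part of degree `a`. -/
def mixedPart (a : ℕ) (g : MvPolynomial σ k) : MvPolynomial σ k :=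
  g - purePart a g

/-- `mixedPart a g + purePart a g = g`. -/
theorem mixedPart_add_purePart (a : ℕ) (g : MvPolynomial σ k) :
    mixedPart a g + purePart a g = g :=
  sub_add_cancel g _

/-- Coefficients of the pure part: only the monomials `x_e^a` survive. -/
theorem coeff_purePart [DecidableEq σ] (a : ℕ) (g : MvPolynomial σ k) (m : σ →₀ ℕ) :
    coeff m (purePart a g) =
      ∑ e : σ, if Finsupp.single e a = m then coeff (Finsupp.single e a) g else 0 := by
  simp only [purePart, coeff_sum, coeff_C_mul, X_pow_eq_monomial, coeff_monomial, mul_ite, mul_one,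
    mul_zero]

/-- For `a ≠ 0` the pure part has the same `x_e^a`-coefficient as `g`. -/
theorem coeff_purePart_single {a : ℕ} (ha : a ≠ 0) (g : MvPolynomial σ k) (e : σ) :
    coeff (Finsupp.single e a) (purePart a g) = coeff (Finsupp.single e a) g := by
  classical
  rw [coeff_purePart, Finset.sum_eq_single e]
  · rw [if_pos rfl]
  · intro e' _ hne
    rw [if_neg]
    intro h
    exact hne (Finsupp.single_left_injective ha h)
  · intro h
    exact absurd (Finset.mem_univ e) h

/-- The pure part has no coefficient outside the monomials `x_e^a`. -/
theorem coeff_purePart_of_ne {a : ℕ} (g : MvPolynomial σ k) {m : σ →₀ ℕ}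
    (hm : ∀ e : σ, Finsupp.single e a ≠ m) : coeff m (purePart a g) = 0 := by
  classical
  rw [coeff_purePart]
  exact Finset.sum_eq_zero fun e _ => if_neg (hm e)

/-- A polynomial with no `x_e^a`-coefficients has zero pure part of degree `a`. -/
theorem purePart_eq_zero_of_coeff {a : ℕ} {g : MvPolynomial σ k}
    (h : ∀ e : σ, coeff (Finsupp.single e a) g = 0) : purePart a g = 0 := by
  simp [purePart, h]

/-- `purePart a` is additive. -/
theorem purePart_add (a : ℕ) (g g' : MvPolynomial σ k) :
    purePart a (g + g') = purePart a g + purePart a g' := by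
  simp only [purePart, coeff_add, C_add, add_mul, Finset.sum_add_distrib]

/-- `purePart a` commutes with scalars. -/
theorem purePart_smul (a : ℕ) (c : k) (g : MvPolynomial σ k) :
    purePart a (c • g) = c • purePart a g := by
  simp only [purePart, Finset.smul_sum, smul_eq_C_mul, coeff_C_mul, C_mul, mul_assoc]

/-- `purePart a` of a linear combination is the linear combination of the pure parts. -/
theorem purePart_linComb {ι : Type*} (a : ℕ) (s : Finset ι) (c : ι → k)
    (p : ι → MvPolynomial σ k) :
    purePart a (∑ i ∈ s, c i • p i) = ∑ i ∈ s, c i • purePart a (p i) := by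
  induction s using Finset.cons_induction with
  | empty => simp [purePart]
  | cons i s hi ih => rw [Finset.sum_cons, Finset.sum_cons, purePart_add, purePart_smul, ih]

/-! ## §2. The mixed part of a homogeneous polynomial has individual degree `≤ a − 1` -/

omit [Fintype σ] in
/-- A monomial of total degree equal to one of its exponents is a pure power. -/
theorem eq_single_of_apply_eq_degree {m : σ →₀ ℕ} {e : σ} (he : m e = m.degree) :
    m = Finsupp.single e (m e) := by
  classical
  have h := Finsupp.single_add_erase e m
  have hdeg : (m.erase e).degree = 0 := by
    have h2 := congrArg Finsupp.degree h
    rw [map_add, Finsupp.degree_single] at h2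
    omega
  rw [Finsupp.degree_eq_zero_iff] at hdeg
  rw [hdeg, add_zero] at h
  exact h.symm

/-- **Key degree bound.** For `g` homogeneous of degree `a ≥ 1`, removing the pure powers `x_e^a`
leaves individual degree `≤ a − 1` in every variable. -/
theorem degreeOf_mixedPart_le {a : ℕ} {g : MvPolynomial σ k} (hg : g.IsHomogeneous a) (ha : 1 ≤ a)
    (e : σ) : degreeOf e (mixedPart a g) ≤ a - 1 := by
  rw [degreeOf_le_iff]
  intro m hm
  rw [mem_support_iff] at hm
  by_cases hpure : ∃ e', Finsupp.single e' a = m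
  · obtain ⟨e', rfl⟩ := hpure
    exact absurd (by rw [mixedPart, coeff_sub, coeff_purePart_single (by omega), sub_self]) hm
  · push Not at hpure
    have hmg : coeff m g ≠ 0 := by
      rwa [mixedPart, coeff_sub, coeff_purePart_of_ne g hpure, sub_zero] at hm
    have hdeg : m.degree = a := by
      by_contra hne
      exact hmg (hg.coeff_eq_zero hne)
    have hle : m e ≤ a := hdeg ▸ Finsupp.le_degree e m
    by_contra hlt
    have hea : m e = a := by omega
    apply hpure e
    rw [eq_single_of_apply_eq_degree (hea.trans hdeg.symm), hea]

/-! ## §3. Individual degrees of the pure parts -/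

omit [Fintype σ] in
/-- `degreeOf e (x_{e'}^n) ≤ n` (for any `e, e'`). -/
theorem degreeOf_X_pow_le' (e e' : σ) (n : ℕ) : degreeOf e ((X e' : MvPolynomial σ k) ^ n) ≤ n := by
  rw [X_pow_eq_monomial, degreeOf_le_iff]
  intro m hm
  have h := support_monomial_subset hm
  rw [Finset.mem_singleton] at h
  rw [h]
  exact (Finsupp.le_degree e _).trans (Finsupp.degree_single e' n).le

omit [Fintype σ] in
/-- `degreeOf e (C c · x_{e'}^n) ≤ n`. -/
theorem degreeOf_C_mul_X_pow_le (e e' : σ) (c : k) (n : ℕ) :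
    degreeOf e (C c * (X e' : MvPolynomial σ k) ^ n) ≤ n :=
  (degreeOf_C_mul_le _ _ _).trans (degreeOf_X_pow_le' e e' n)

omit [Fintype σ] in
/-- `degreeOf e (C c · x_{e'}^n) = 0` for `e ≠ e'`. -/
theorem degreeOf_C_mul_X_pow_of_ne {e e' : σ} (h : e ≠ e') (c : k) (n : ℕ) :
    degreeOf e (C c * (X e' : MvPolynomial σ k) ^ n) = 0 :=
  Nat.le_zero.mp ((degreeOf_C_mul_le _ _ _).trans (degreeOf_X_pow_of_ne n h).le)

/-- The pure part of degree `a` has individual degree `≤ a`. -/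
theorem degreeOf_purePart_le (a : ℕ) (g : MvPolynomial σ k) (e : σ) :
    degreeOf e (purePart a g) ≤ a := by
  refine (degreeOf_sum_le _ _ _).trans (Finset.sup_le fun e' _ => ?_)
  exact degreeOf_C_mul_X_pow_le e e' _ a

/-- The pure part with the `x_e`-term removed: `Σ_{e' ≠ e} coeff(x_{e'}^b) h · x_{e'}^b`. -/
def purePartOff [DecidableEq σ] (b : ℕ) (h : MvPolynomial σ k) (e : σ) : MvPolynomial σ k :=
  ∑ e' ∈ Finset.univ.erase e, C (coeff (Finsupp.single e' b) h) * X e' ^ b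

/-- Removing the `x_e`-term from the pure part gives `purePartOff`. -/
theorem purePart_sub_eq_purePartOff [DecidableEq σ] (b : ℕ) (h : MvPolynomial σ k) (e : σ) :
    purePart b h - C (coeff (Finsupp.single e b) h) * X e ^ b = purePartOff b h e := by
  rw [purePartOff, purePart, Finset.sum_erase_eq_sub (Finset.mem_univ e)]

/-- `purePartOff b h e` does not involve `x_e`. -/
theorem degreeOf_purePartOff_self [DecidableEq σ] (b : ℕ) (h : MvPolynomial σ k) (e : σ) :
    degreeOf e (purePartOff b h e) = 0 := by
  refine Nat.le_zero.mp ((degreeOf_sum_le _ _ _).trans (Finset.sup_le fun e' he' => ?_))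
  exact (degreeOf_C_mul_X_pow_of_ne (Finset.ne_of_mem_erase he').symm _ _).le

/-- `purePartOff b h e` has individual degree `≤ b`. -/
theorem degreeOf_purePartOff_le [DecidableEq σ] (b : ℕ) (h : MvPolynomial σ k) (e e' : σ) :
    degreeOf e' (purePartOff b h e) ≤ b := by
  refine (degreeOf_sum_le _ _ _).trans (Finset.sup_le fun e'' _ => ?_)
  exact degreeOf_C_mul_X_pow_le e' e'' _ b

/-! ## §4. The coefficient of `x_e^{a+b}` in a product of homogeneous polynomials -/

omit [Fintype σ] in
/-- For `g` homogeneous of degree `a` (and any `h`), the only way to produce `x_e^{a+b}` in `g · h`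
is `x_e^a · (x_e^b`-term of `h`)`. -/
theorem coeff_single_mul_of_isHomogeneous {a : ℕ} {g : MvPolynomial σ k}
    (hg : g.IsHomogeneous a) (b : ℕ) (h : MvPolynomial σ k) (e : σ) :
    coeff (Finsupp.single e (a + b)) (g * h) =
      coeff (Finsupp.single e a) g * coeff (Finsupp.single e b) h := by
  classical
  rw [coeff_mul, Finsupp.antidiagonal_single, Finset.sum_map]
  simp only [Function.Embedding.coe_prodMap, Function.Embedding.coeFn_mk, Prod.map_fst,
    Prod.map_snd]
  rw [Finset.sum_eq_single (a, b)]
  · intro p hp hne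
    rw [Finset.mem_antidiagonal] at hp
    have h1 : p.1 ≠ a := by
      intro h1
      apply hne
      exact Prod.ext h1 (by omega)
    rw [hg.coeff_eq_zero (by rw [Finsupp.degree_single]; exact h1), zero_mul]
  · intro hab
    exact (hab (Finset.mem_antidiagonal.mpr rfl)).elim

/-- The pure part of degree `a + b` of `g · h`, `g` homogeneous of degree `a`:
`Σ_e C(coeff(x_e^a) g · coeff(x_e^b) h) · x_e^{a+b}`. -/
theorem purePart_mul_of_isHomogeneous {a : ℕ} {g : MvPolynomial σ k}
    (hg : g.IsHomogeneous a) (b : ℕ) (h : MvPolynomial σ k) :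
    purePart (a + b) (g * h) =
      ∑ e : σ, C (coeff (Finsupp.single e a) g * coeff (Finsupp.single e b) h) * X e ^ (a + b) := by
  classical
  unfold purePart
  exact Finset.sum_congr rfl fun e _ => by rw [coeff_single_mul_of_isHomogeneous hg b h e]

/-! ## §5. The purification identity and the legality of its products -/

/-- The legal expression for the purified product (the right-hand side of NOTE-g21 Lemma 1):
`ĝ·ĥ + ĝ·P_h + P_g·ĥ + Σ_e (C α_e x_e^a)·(P_h − C β_e x_e^b)`. -/
def purifiedProduct (a b : ℕ) (g h : MvPolynomial σ k) : MvPolynomial σ k :=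
  mixedPart a g * mixedPart b h + mixedPart a g * purePart b h + purePart a g * mixedPart b h +
    ∑ e : σ, (C (coeff (Finsupp.single e a) g) * X e ^ a) *
      (purePart b h - C (coeff (Finsupp.single e b) h) * X e ^ b)

/-- The purification identity, ring-theoretic form (no homogeneity needed):
the legal expression equals `g·h − Σ_e C(α_e β_e) x_e^{a+b}`. -/
theorem purifiedProduct_eq (a b : ℕ) (g h : MvPolynomial σ k) :
    purifiedProduct a b g h =
      g * h - ∑ e : σ, C (coeff (Finsupp.single e a) g * coeff (Finsupp.single e b) h) * X e ^ (a + b) := by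
  have h1 : ∑ e : σ, (C (coeff (Finsupp.single e a) g) * X e ^ a) * purePart b h =
      purePart a g * purePart b h := by
    rw [show purePart a g = ∑ e : σ, C (coeff (Finsupp.single e a) g) * X e ^ a from rfl,
      Finset.sum_mul]
  have h2 : ∀ e : σ, (C (coeff (Finsupp.single e a) g) * X e ^ a) *
      (C (coeff (Finsupp.single e b) h) * X e ^ b) =
      C (coeff (Finsupp.single e a) g * coeff (Finsupp.single e b) h) * X e ^ (a + b) := by
    intro e
    rw [C_mul, pow_add]
    ring
  have hsum : ∑ e : σ, (C (coeff (Finsupp.single e a) g) * X e ^ a) *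
      (purePart b h - C (coeff (Finsupp.single e b) h) * X e ^ b) =
      purePart a g * purePart b h -
        ∑ e : σ, C (coeff (Finsupp.single e a) g * coeff (Finsupp.single e b) h) * X e ^ (a + b) := by
    simp only [mul_sub, Finset.sum_sub_distrib, h1, h2]
  have key : g * h = (mixedPart a g + purePart a g) * (mixedPart b h + purePart b h) := by
    rw [mixedPart_add_purePart, mixedPart_add_purePart]
  rw [purifiedProduct, hsum, key]
  ring

/-- **Purification identity** (NOTE-g21 Lemma 1, j = 1): for homogeneous `g` of degree `a` (and any
`h`; in the application `h` is homogeneous of degree `b`) the legal expression computes exactly the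
mixed part of `g·h` in degree `a + b`. -/
theorem purification_identity {a : ℕ} {g : MvPolynomial σ k}
    (hg : g.IsHomogeneous a) (b : ℕ) (h : MvPolynomial σ k) :
    purifiedProduct a b g h = mixedPart (a + b) (g * h) := by
  rw [purifiedProduct_eq, mixedPart, purePart_mul_of_isHomogeneous hg b h]

/-- **Every product of the legal expression is a legal gate** of a multi-`(a+b−1)`-ic circuit:
individual degree `≤ a + b − 1` in every variable (`a, b ≥ 1`). The first product even has
individual degree `≤ a + b − 2`. -/
theorem legal_products {a b : ℕ} {g h : MvPolynomial σ k}
    (hg : g.IsHomogeneous a) (hh : h.IsHomogeneous b) (ha : 1 ≤ a) (hb : 1 ≤ b) (e : σ) :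
    degreeOf e (mixedPart a g * mixedPart b h) ≤ a + b - 2 ∧
    degreeOf e (mixedPart a g * purePart b h) ≤ a + b - 1 ∧
    degreeOf e (purePart a g * mixedPart b h) ≤ a + b - 1 ∧
    ∀ e' : σ, degreeOf e ((C (coeff (Finsupp.single e' a) g) * X e' ^ a) *
      (purePart b h - C (coeff (Finsupp.single e' b) h) * X e' ^ b)) ≤ a + b - 1 := by
  classical
  have hMg := degreeOf_mixedPart_le hg ha e
  have hMh := degreeOf_mixedPart_le hh hb e
  have hPg := degreeOf_purePart_le a g e
  have hPh := degreeOf_purePart_le b h e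
  refine ⟨(degreeOf_mul_le _ _ _).trans (by omega), (degreeOf_mul_le _ _ _).trans (by omega),
    (degreeOf_mul_le _ _ _).trans (by omega), fun e' => ?_⟩
  rw [purePart_sub_eq_purePartOff]
  refine (degreeOf_mul_le _ _ _).trans ?_
  by_cases hee : e = e'
  · subst hee
    have h1 := degreeOf_C_mul_X_pow_le e e (coeff (Finsupp.single e a) g) a
    have h2 := degreeOf_purePartOff_self b h e
    omega
  · have h1 := degreeOf_C_mul_X_pow_of_ne hee (coeff (Finsupp.single e' a) g) a
    have h2 := degreeOf_purePartOff_le b h e' e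
    omega

/-- **Every factor of the legal expression is itself legal** (individual degree `≤ a + b − 1`), as it
must be, being the value of a gate. -/
theorem legal_factors {a b : ℕ} {g h : MvPolynomial σ k}
    (hg : g.IsHomogeneous a) (hh : h.IsHomogeneous b) (ha : 1 ≤ a) (hb : 1 ≤ b) (e : σ) :
    degreeOf e (mixedPart a g) ≤ a + b - 1 ∧ degreeOf e (mixedPart b h) ≤ a + b - 1 ∧
    degreeOf e (purePart a g) ≤ a + b - 1 ∧ degreeOf e (purePart b h) ≤ a + b - 1 ∧
    ∀ e' : σ, degreeOf e (C (coeff (Finsupp.single e' a) g) * X e' ^ a) ≤ a + b - 1 ∧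
      degreeOf e (purePart b h - C (coeff (Finsupp.single e' b) h) * X e' ^ b) ≤ a + b - 1 := by
  classical
  have hMg := degreeOf_mixedPart_le hg ha e
  have hMh := degreeOf_mixedPart_le hh hb e
  have hPg := degreeOf_purePart_le a g e
  have hPh := degreeOf_purePart_le b h e
  refine ⟨by omega, by omega, by omega, by omega, fun e' => ⟨?_, ?_⟩⟩
  · exact (degreeOf_C_mul_X_pow_le e e' _ a).trans (by omega)
  · rw [purePart_sub_eq_purePartOff]
    exact (degreeOf_purePartOff_le b h e' e).trans (by omega)

/-- The purified product itself is legal: individual degree `≤ a + b − 1`. -/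
theorem degreeOf_purifiedProduct_le {a b : ℕ} {g h : MvPolynomial σ k}
    (hg : g.IsHomogeneous a) (hh : h.IsHomogeneous b) (ha : 1 ≤ a) (e : σ) :
    degreeOf e (purifiedProduct a b g h) ≤ a + b - 1 := by
  rw [purification_identity hg b h]
  exact degreeOf_mixedPart_le (hg.mul hh) (by omega) e

/-! ## §6. The top layer: purifying every top product does not change a pure-power-free output -/

/-- If `f = Σ_i c_i • p_i` has no pure monomial `x_e^d`, then `f = Σ_i c_i • mixedPart d p_i`:
the pure parts of the summands cancel. (Applied with `p_i = g_i · h_i` the top product gates of a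
homogenised circuit for a multilinear — more generally pure-power-free — `f` of degree `d`.) -/
theorem top_layer {ι : Type*} (d : ℕ) (s : Finset ι) (c : ι → k) (p : ι → MvPolynomial σ k)
    {f : MvPolynomial σ k} (hf : f = ∑ i ∈ s, c i • p i)
    (hpure : ∀ e : σ, coeff (Finsupp.single e d) f = 0) :
    f = ∑ i ∈ s, c i • mixedPart d (p i) := by
  have h0 : purePart d f = 0 := purePart_eq_zero_of_coeff hpure
  rw [hf, purePart_linComb] at h0
  simp only [mixedPart, smul_sub, Finset.sum_sub_distrib, h0, sub_zero]
  exact hf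

/-- **Summary (NOTE-g21 Lemma 1, j = 1, algebraic core).** For a top product gate `g · h` of a
homogenised circuit (`g`, `h` homogeneous of degrees `a, b ≥ 1`): the mixed part of `g · h` is computed
by the `#σ + 3` products of `purifiedProduct`, each of individual degree `≤ a + b − 1`, from factors of
individual degree `≤ a + b − 1` that are linear combinations of `g`, `h`, the constants
`coeff(x_e^a) g`, `coeff(x_e^b) h` and the powers `x_e^a`, `x_e^b`; and (`top_layer`) summing the
mixed parts with the circuit's top-layer weights returns `f` whenever `f` has no pure monomial of
degree `a + b`. -/
theorem topNotchPurification {a b : ℕ} {g h : MvPolynomial σ k}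
    (hg : g.IsHomogeneous a) (hh : h.IsHomogeneous b) (ha : 1 ≤ a) (hb : 1 ≤ b) :
    purifiedProduct a b g h = mixedPart (a + b) (g * h) ∧
    (∀ e : σ, degreeOf e (purifiedProduct a b g h) ≤ a + b - 1) ∧
    (∀ e : σ, degreeOf e (mixedPart a g * mixedPart b h) ≤ a + b - 2 ∧
      degreeOf e (mixedPart a g * purePart b h) ≤ a + b - 1 ∧
      degreeOf e (purePart a g * mixedPart b h) ≤ a + b - 1 ∧
      ∀ e' : σ, degreeOf e ((C (coeff (Finsupp.single e' a) g) * X e' ^ a) *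
        (purePart b h - C (coeff (Finsupp.single e' b) h) * X e' ^ b)) ≤ a + b - 1) :=
  ⟨purification_identity hg b h, fun e => degreeOf_purifiedProduct_le hg hh ha e,
    fun e => legal_products hg hh ha hb e⟩

end Summit.ValiantsHypothesis.ValiantsHypothesis.Theorems.IndividualDegreePurification
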